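import Summits.AtomisticToContinuum.HydrodynamicLimit.Theses.CollisionIsometryCLT
import Summits.AtomisticToContinuum.HydrodynamicLimit.Theses.StiffCollisionalRelaxation
import Summits.AtomisticToContinuum.HydrodynamicLimit.Theses.ImplosionDichotomy
import Summits.AtomisticToContinuum.HydrodynamicLimit.Theorems.CollisionIsometryCLTMacroClosureBarycentricDefs
import Summits.AtomisticToContinuum.HydrodynamicLimit.Theorems.DenseExcursion.Negative.Dichotomy
import Summits.AtomisticToContinuum.HydrodynamicLimit.Theorems.DenseExcursion.Negative.Everywhere
import Literature.MathematicalPhysics.KineticTheory.HardSphereEulerProofs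

/-!
# Disproof of `MacroClosure` (stmt-AtomisticToContinuum-14870) — findings

Route decl (rev 12–13):
`Summit.AtomisticToContinuum.HydrodynamicLimit.Theses.CollisionIsometryCLT.MacroClosure :=
CollisionalTransferLocality → AprioriBoundsPreShock → FastMomentRelaxationPreShock → _root_.HydrodynamicLimit`.
Standing adversary: refuter-cdisprove-stmt-AtomisticToContinuum-14870-0 (cycle 1 on the re-typed item,
2026-08-16); it EXTENDS the cycle-1 workfile of the retired item stmt-14670 (same path), whose §§2–7
(`AprioriBounds → HydrodynamicLimit → PackingCeilingOne`, landed as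
`Theorems/MacroClosure/Negative/PackingCeiling.lean`, p-accepted) were keyed on the RETIRED ∀-t decl
`CollisionIsometryCLT.AprioriBounds` (stmt-9519) and no longer elaborate (migration debt, see §7).
Prose lives in docstrings; the file is `lean check` rc 0, sorry-free, axioms ⊆ {propext, Classical.choice,
Quot.sound}.

## Read-back of the re-typed crux (symbol by symbol)

* An IMPLICATION between three closed particle-level `Prop`s and the summit conjunct. New in rev 12: the
  second and third hypotheses are CONDITIONED, exactly like the conjunct, on a classical hs-Euler solution
  `IsHardSphereEulerSolution σ T ρ u θ` with LLN-matching local Gibbs data (`TendstoHydroFieldsAt … 0`), and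
  claimed only for `0 < t < T` under the DILUTE PROVISO `∀ s ∈ Icc 0 t, ∀ x, 2 * ρ s x * σ ^ 3 < η₁`, where
  `η₁ > 0` is EXISTENTIAL (`∃ σ₀, 0 < σ₀ ∧ ∃ η₁, 0 < η₁ ∧ ∀ σ < σ₀ …`, chosen by whoever proves the hypothesis,
  before `σ`).  `AprioriBoundsPreShock` is byte-identical with `StiffCollisionalRelaxation.AprioriBounds`
  (stmt-14827, `aprioriBoundsPreShock_iff_stiff`); `CollisionalTransferLocality` is the shared 9518
  (`collisionalTransferLocality_iff_stiff`); the ∀-t hinge 9522 (`StiffCollisionalRelaxation.FastMomentRelaxation`)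
  implies the pre-shock hinge (`fmrPreShock_of_fmr`, η₁ := 1, the proviso unused).
* No coercion / junk operator of its own.  Inherited: `ub := (ρb)⁻¹ • mb` (junk `0` on empty blocks) inside the
  target; `hsPressure`/`hsExcessFreeEnergy` junk (`limsup`, `deriv`, `Real.log 0 = 0`: `f_ex = 0` beyond close
  packing `ρσ³ > √2`) inside `IsHardSphereEulerSolution`; the proviso keeps every consumed instance dilute.
* The proviso is NOT a vacuity channel (§3): admissible solutions have unit mass (`∫ ρ_s = 1`,
  `DenseExcursionEverywhere.integral_density_eq/…_zero_eq_one`), so `sup_x ρ_s ≥ 1` and the proviso forces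
  `2σ³ < η₁` (`two_mul_pow_three_lt_of_proviso`, at ANY single time `s`; the `s = 0` form was LANDED today by
  the 14827 disprover: `AprioriBoundsNegative.two_mul_pow_three_lt_of_dilute(_localGibbs)`,
  `Theorems/AprioriBounds/Negative/EquilibriumRung.lean`, cited) — the hypotheses say NOTHING at
  `σ ≥ (η₁/2)^{1/3}` but cannot be emptied by the choice of `η₁`, because `∀ σ < σ₀` reaches `σ → 0` where
  near-uniform solutions satisfy it.

## Findings (this cycle)

1. NO KILL IS POSSIBLE IN PRINCIPLE WITHOUT SETTLING THE SUMMIT (§1, re-keyed, checked):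
   `HydrodynamicLimit → MacroClosure`, `¬ MacroClosure ↔ (CTL ∧ APS ∧ FMRPS ∧ ¬ HydrodynamicLimit)`; every
   weakening by dropping hypotheses stays implied by the conjunct (`weakening_irrefutable`), so no
   `_false_without_H` theorem exists; refuting any hypothesis proves the crux ex falso (`macroClosure_of_not_hyp`)
   — none is refuted (9518: lead line running; 14827: refuter-stamped restatement whose negative lemmas
   PersistentVacuum/HotSpot live at `t ≥ T`; 14902: false only at `σ = 0`, excluded).
2. THE OLD TENSION IS GONE, AND NOTHING REPLACES IT (§2): the cycle-1 reduction
   `AprioriBounds(∀ t) ∧ HydrodynamicLimit → PackingCeilingOne` used component (ii) WITHOUT proviso; under the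
   pre-shock proviso (ii) only speaks where `ρσ³ < η₁/2 ≤ …` already holds, so the item set no longer asserts a
   packing ceiling.  The conjunct ALONE still bounds admissible solutions by the sphere-volume ceiling
   `ρ_t σ³ ≤ 6/π` (disjoint balls of radius `ε/2`; paper, §7) — but `6/π > √2`, and a smooth typed solution
   cannot cross close packing `√2` from dilute LLN data (the typed pressure `ρθZ(ρσ³)` is unbounded as
   `ρσ³ ↑ √2` off a null set of kinks while `∂ₜ(ρu) + div(ρu⊗u)` stays bounded), so this residual "ceiling" is
   physically and typed-wise empty: not worth a lemma.  Verdict: the re-typing removed the only kernel-checked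
   objection to the item set; the crux is now EXACTLY as safe as the conjunct restricted to the kinetic
   hypotheses' silence outside the chamber.
3. POSITION AMONG TYPED ITEMS (§2, checked): `MacroClosure → (CTL → StiffCollisionalRelaxation.AprioriBounds → StiffCollisionalRelaxation.FastMomentRelaxation
   → HL)` (`macroClosure_stiffShape`), i.e. the new crux is STRONGER than the Stiff-keyed interface; conversely
   the Stiff dock `EulerRelEntropyDock` (stmt-14956) consumes the ∀-t hinge 9522 and yields only that weaker
   interface (`stiffShape_of_dock`).  So, as typed today, NO item set in the tree gives `MacroClosure` by pure
   logic: the route text's "Assembly 11094 re-keyed on the pre-shock hinge" is a RE-PROOF obligation (every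
   step of the Stiff bookkeeping must be re-run with FMR available only for `t < T` under the proviso — harmless
   on paper since the bookkeeping lives on `[0,t₁] ⊂ [0,T)` inside the chamber, but not a citation).
4. THE PICKED LINE `IdeatorTwoGen1Sketch` (barycentric Bregman / invariant Clausius; §4, checked where typed):
   (a) `stub_chamber` is EXACTLY the negation of the `ImplosionDichotomy` crux `DenseExcursion` (stmt-12586,
   staffed, its own route doc says "Expected FALSE for focusing profiles"): `stub_chamber_iff_not_denseExcursion`
   (tree lemma `not_denseExcursion_iff_diluteSelfConsistency`).  It is LOAD-BEARING FOR THE LINE BUT NOT FOR THE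
   CRUX: `HydrodynamicLimit → EngineLocal` (`engineLocal_of_hydrodynamicLimit`) and
   `EngineLocal → DiluteSelfConsistency → HydrodynamicLimit` (`hydrodynamicLimit_of_engineLocal_of_dsc`), so the
   line proves `HL` outright from `EngineLocal ∧ 3091`, while `MacroClosure` itself survives `DenseExcursion`
   (a dense excursion to moderate packing is still expected to be tracked by the gas; only this PROOF dies).
   Under `DenseExcursion` the line is dead and the lead must either (i) prove `EngineLocal` with `η` ABOVE the
   excursion level of the offending profiles (impossible uniformly: `DenseExcursion` fixes `η*` first) or
   (ii) re-dock on `HydroLimitInBand` (stmt-9133, `∃ η₀` BEFORE `∀ profiles` — note `EngineLocal` has the weaker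
   order `∀ profiles ∃ η`, `hydroLimitInBand_engineLocal`).
   (b) Paper audit of the five analytic stubs — NO KILL, all survive the cheap attacks, details in §4 docstrings:
   `stub_thermo` (Λ-formula re-derived term by term incl. the constant `5/2`; compatibility = symmetry of
   `D²η·DFⱼ` = thermodynamic consistency `p = ρ²∂_ρf`, `s = −∂_θ f`, `e = 3θ/2` ✓; coercivity `min(|·|²,|·|)`
   is the right shape: vacuum direction → `Z(σ³)`, hot direction linear `E/θ_U`, cold direction `+∞`; needs
   CONVEXITY of `η_σ` on the band `ρσ³ < 1.1` = 9526, across freezing 0.94 — true for the thermodynamic limit,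
   Ruelle-level to formalise; `∀ σ > 0` is harmless, everything is in reduced units);
   `stub_balance` (B3 exact algebra re-derived INCLUDING the empty block `ρ̄ = 0`, where `ū = θ̄ = D = q = 0` by
   junk arithmetic and both sides vanish; B1 holds at `τ = 0` because `HardSphereFlow.flow_zero` is an axiom of
   the structure; B2/B4 elementary); `stub_blockMGF` (sub-unit tilt is TIGHT: a block of `n` particles has
   `E θ̄^{−3γ'n/2} < ∞` iff `γ' < 1 − 1/n` (χ²_{3(n−1)} small balls), so the statement is FALSE with `∀ N` in
   place of `∀ᶠ N` and FALSE at `γ' = 1` for every `N` — the typed order `∀ γ' < 1, ∀ ε, ∀ᶠ N` is exactly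
   right; dense blocks on the band need the LD upper bound with the TRUE free energy up to packing 1 —
   statics of crystal-nucleation depth, upper-bound direction only); `stub_initialEntropy` (ideal-gas check:
   `(N+1)⁻¹KL = ∫ρ₀ log ρ₀ + ∫ρ₀ KL(M₀‖M_c)` equals `∫ h(U₀|U_c)` ✓ using `∫ρ₀ = 1`; at `σ > 0` it is the LDA
   limit of the inhomogeneous canonical log-partition function + convexity of `η log η + η f_ex(ησ³…)` so that
   the homogeneous infimum sits at `ρ ≡ 1`; equilibrium consistency `relEnt σ U U = 0` is `relEnt_self`);
   `stub_clausius` (entropy inequality against the flow-INVARIANT homogeneous law — invariance is LANDED,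
   `AprioriBoundsNegative.measurePreserving_regFlow_localGibbsMeasure` — + data processing + exact conservation
   of the totals; the Bregman terms telescope exactly; `h ≤ h⁺` is the right direction; integrability on `G`
   follows from the same inequality since `E_G θ̄^{−αn} < ∞` for `αn < 3(n−1)/2`);
   `stub_engine` (the Gronwall closes on paper with `g := δ' − ℓ_N ≥ 0`: `H_N ≤ g`, `g' ≤ C_M g + e`,
   `g(0) → δ'`; the flux remainder is CUBIC against a QUADRATIC entropy — `sum_norm_cube_le` §5 and the
   drift family `V_λ = stateOf 1 (λe₁) 1`: `relEnt = λ²/2`, energy-flux remainder `λ³/2` — so the `√M`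
   truncation with the AB(i) Chebyshev tail `e^{−λM/4}` is NECESSARY, as the lead already plans; this is the
   catalogued `HighMomentumCutoffBarrierNarrow` met Nachtergaele–Yau style, not evaded).
   (c) Barrier grading of the line: `WildSolutionsBarrier` (non-uniqueness of admissible weak solutions) is
   evaded honestly — the selection principle is Clausius-in-mean from Liouville invariance + `H ≥ 0`, and the
   comparison solution is CLASSICAL (weak–strong, Dafermos 5.2.1); `ShockFormationBarrier` respected (`t < T`);
   `MacroErgodicityHypothesisBarrier` sits upstream (the one-block replacement IS the hypotheses CTL/FMR);
   `HighMomentumCutoffBarrierNarrow` met through AB(i) exactly as its narrowed record prescribes.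
5. WHAT A KILL WOULD STILL NEED (§6): the three kinetic hypotheses PROVED and the conjunct REFUTED; or, for the
   line only, `DenseExcursion` PROVED (then `stub_chamber` is false by `stub_chamber_iff_not_denseExcursion`).

## Index
* §1 Structure (re-keyed): `macroClosure_iff`, `assembly_candidate`, `macroClosure_of_hydrodynamicLimit`,
  `not_macroClosure_iff`, `not_hydrodynamicLimit_of_not_macroClosure`, `macroClosure_of_not_hyp`,
  `weakening_irrefutable`.
* §2 Shared items: `aprioriBoundsPreShock_iff_stiff`, `collisionalTransferLocality_iff_stiff`,
  `diluteSelfConsistency_iff_stiff`, `fmrPreShock_of_fmr`, `macroClosure_stiffShape`, `stiffShape_of_dock`.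
* §3 The proviso: `exists_one_le_density` (= landed `AprioriBoundsNegative.exists_one_le_of_integral_eq_one`, local copy
  to keep this workfile independent of that module), `two_mul_pow_three_lt_of_proviso`.
* §4 The line: `stub_chamber_iff_not_denseExcursion`, `engineLocal_of_hydrodynamicLimit`,
  `hydrodynamicLimit_of_engineLocal_of_dsc`, `macroClosure_of_line`, `hydroLimitInBand_engineLocal`,
  `relEnt_self`.
* §5 `sum_norm_cube_le`, `sum_norm_cube_eq_of_single` (cubic current vs energy, tight).
* §6 Near-misses / what a kill would need (prose).  §7 Migration debt (prose).
-/

noncomputable section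

open MeasureTheory Filter Set Topology
open scoped ENNReal

namespace Summit.AtomisticToContinuum.HydrodynamicLimit.Cruxes.MacroClosure.Disproof

open Literature.MathematicalPhysics.KineticTheory Literature.Analysis.FluidPDE
open Summit.AtomisticToContinuum.HydrodynamicLimit.Theorems
open Summit.AtomisticToContinuum.HydrodynamicLimit.Theses.CollisionIsometryCLT

open Summit.AtomisticToContinuum.HydrodynamicLimit.Theses

/-! ## §1 Structure of the crux: an implication weaker than the conjunct (re-keyed on rev 12) -/

/-- Unfolding. -/
theorem macroClosure_iff :
    MacroClosure ↔ (CollisionalTransferLocality → AprioriBoundsPreShock → FastMomentRelaxationPreShock →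
      _root_.HydrodynamicLimit) := Iff.rfl

/-- The rev-12 `Assembly` (stmt-14872) is pure logic over the crux and is the type of the route's own deciding
theorem — recorded as a candidate (not this seat's to land; it is closed on the ledger). -/
theorem assembly_candidate : Assembly := fun hD hC h₃ h₂ hM => closes hD hC h₃ h₂ hM

/-- The crux is WEAKER than the summit conjunct (its hypotheses are proof aids). -/
theorem macroClosure_of_hydrodynamicLimit (h : _root_.HydrodynamicLimit) : MacroClosure :=
  fun _ _ _ => h

/-- **What a disproof would be**: the three open kinetic items proved AND the conjunct refuted. -/
theorem not_macroClosure_iff :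
    ¬ MacroClosure ↔ (CollisionalTransferLocality ∧ AprioriBoundsPreShock ∧ FastMomentRelaxationPreShock ∧
      ¬ _root_.HydrodynamicLimit) := by
  constructor
  · intro h
    by_contra hcon
    refine h fun h₂ h₃ hF => ?_
    by_contra hHL
    exact hcon ⟨h₂, h₃, hF, hHL⟩
  · rintro ⟨h₂, h₃, hF, hHL⟩ h
    exact hHL (h h₂ h₃ hF)

/-- In particular a disproof of the crux refutes the summit conjunct. -/
theorem not_hydrodynamicLimit_of_not_macroClosure (h : ¬ MacroClosure) : ¬ _root_.HydrodynamicLimit :=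
  fun hHL => h (macroClosure_of_hydrodynamicLimit hHL)

/-- **Vacuity channels**: refuting ANY hypothesis proves the crux (ex falso). None is refuted today. -/
theorem macroClosure_of_not_hyp
    (h : ¬ CollisionalTransferLocality ∨ ¬ AprioriBoundsPreShock ∨ ¬ FastMomentRelaxationPreShock) :
    MacroClosure := by
  intro h₂ h₃ hF
  rcases h with h | h | h <;> exact absurd ‹_› h

/-- **No `_false_without_H` theorem can exist**: every weakening `W` of the crux that is still implied by the
conjunct (dropping or weakening hypotheses keeps this property) can only be refuted by refuting the
conjunct. -/
theorem weakening_irrefutable {W : Prop} (hW : _root_.HydrodynamicLimit → W) (hnot : ¬ W) :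
    ¬ _root_.HydrodynamicLimit := fun h => hnot (hW h)

/-! ## §2 Position among the shared typed items (`StiffCollisionalRelaxation`, `ImplosionDichotomy`) -/

/-- `AprioriBoundsPreShock` is byte-identical with the Stiff route's `AprioriBounds` (both are stmt-14827). -/
theorem aprioriBoundsPreShock_iff_stiff : AprioriBoundsPreShock ↔ StiffCollisionalRelaxation.AprioriBounds := Iff.rfl

/-- `CollisionalTransferLocality` is the shared stmt-9518. -/
theorem collisionalTransferLocality_iff_stiff :
    CollisionalTransferLocality ↔ StiffCollisionalRelaxation.CollisionalTransferLocality := Iff.rfl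

/-- The two copies of stmt-3091 (`ImplosionDichotomy` / Stiff) are byte-identical. -/
theorem diluteSelfConsistency_iff_stiff :
    ImplosionDichotomy.DiluteSelfConsistency ↔ StiffCollisionalRelaxation.DiluteSelfConsistency := Iff.rfl

/-- **The ∀-t hinge implies the pre-shock hinge** (stmt-9522 ⟹ stmt-14902): drop the Euler conditioning and the
dilute proviso (`η₁ := 1`).  So `FastMomentRelaxationPreShock` is the WEAKER statement and `MacroClosure`,
which consumes it, the STRONGER interface. -/
theorem fmrPreShock_of_fmr (h : StiffCollisionalRelaxation.FastMomentRelaxation) : FastMomentRelaxationPreShock := by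
  intro a₀ θ₀ u₀ ha hθ hu ha0 hθ0
  obtain ⟨σ₀, hσ₀, H⟩ := h a₀ θ₀ u₀ ha hθ hu ha0 hθ0
  refine ⟨σ₀, hσ₀, 1, one_pos, ?_⟩
  intro σ hσ hσlt T ρ θ u _hsol Φ _hLLN γ C φ hγ hγ' hadm ρb mb ub D q t ht _htT _hdil δ hδ
  exact H σ hσ hσlt Φ γ C φ hγ hγ' hadm t ht δ hδ

/-- **The new crux implies the Stiff-keyed interface** `CTL → AprioriBounds(14827) → FMR(9522) → HL`. -/
theorem macroClosure_stiffShape (hM : MacroClosure) :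
    StiffCollisionalRelaxation.CollisionalTransferLocality → StiffCollisionalRelaxation.AprioriBounds → StiffCollisionalRelaxation.FastMomentRelaxation →
      _root_.HydrodynamicLimit :=
  fun h₂ h₃ hF => hM h₂ h₃ (fmrPreShock_of_fmr hF)

/-- **The Stiff dock yields only the Stiff-keyed interface.**  `EulerRelEntropyDock` (stmt-14956) consumes the
∀-t hinge 9522; fed with the macroscopic items it returns `CTL → AprioriBounds → FMR(9522) → HL`, NOT
`MacroClosure` (which must work from the weaker pre-shock hinge).  Pure logic; documents finding 3. -/
theorem stiffShape_of_dock (hD : StiffCollisionalRelaxation.EulerRelEntropyDock) (h₄ : StiffCollisionalRelaxation.RelEntropyStability)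
    (h₅ : StiffCollisionalRelaxation.SecondLawInProbability) (h₉ : StiffCollisionalRelaxation.DiluteSelfConsistency) :
    StiffCollisionalRelaxation.CollisionalTransferLocality → StiffCollisionalRelaxation.AprioriBounds → StiffCollisionalRelaxation.FastMomentRelaxation →
      _root_.HydrodynamicLimit :=
  fun h₂ h₃ hF => hD hF h₂ h₃ h₄ h₅ h₉

/-! ## §3 The dilute proviso cannot empty the hypotheses, but silences them at `σ ≥ (η₁/2)^{1/3}` -/

/-- A continuous density of unit mass on the unit torus reaches `1` somewhere.  (Local copy of the landed
`AprioriBoundsNegative.exists_one_le_of_integral_eq_one`, `Theorems/AprioriBounds/Negative/EquilibriumRung.lean`,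
kept so that this workfile does not depend on that module.) -/
theorem exists_one_le_density {f : T3 → ℝ} (hf : Continuous f) (h1 : ∫ x, f x = 1) : ∃ x, 1 ≤ f x := by
  by_contra hcon
  push Not at hcon
  have hpos : 0 < ∫ x, (1 - f x) :=
    (continuous_const.sub hf).integral_pos_of_hasCompactSupport_nonneg_nonzero (x := 0)
      (HasCompactSupport.of_support_subset_isCompact isCompact_univ (subset_univ _))
      (fun x => (sub_pos.2 (hcon x)).le) (sub_pos.2 (hcon 0)).ne'
  have hsub : ∫ x, (1 - f x) = (∫ _x : T3, (1 : ℝ)) - ∫ x, f x :=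
    integral_sub (integrable_const 1) (integrable_of_continuous_T3 hf)
  have hone : ∫ _x : T3, (1 : ℝ) = 1 := by simp
  rw [hsub, hone, h1, sub_self] at hpos
  exact lt_irrefl _ hpos

/-- **The proviso forces `2σ³ < η₁`.**  For an admissible classical solution (its `t = 0` fields are the LLN
limit of the local Gibbs laws, `σ ≤ 1/2`) the dilute proviso `∀ x, 2 ρ_s(x) σ³ < η₁` at any `s ∈ [0,T)`
implies `2σ³ < η₁`: mass is one at EVERY time (`integral_density_eq`, `integral_density_zero_eq_one`) and
the torus has volume one (`exists_one_le_density`).  Hence at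
`(η₁/2)^{1/3} ≤ σ < σ₀` the hypotheses `AprioriBoundsPreShock`/`FastMomentRelaxationPreShock` (and the
target) assert NOTHING — their content lives at small `σ`, which `∀ σ < σ₀` always reaches, so the
existential `η₁` is not a vacuity channel either.  (Single-time variant of the landed `s = 0` lemma
`AprioriBoundsNegative.two_mul_pow_three_lt_of_dilute`.) -/
theorem two_mul_pow_three_lt_of_proviso {σ : ℝ} (hσ0 : 0 ≤ σ) (hσ : σ ≤ 1 / 2) {a₀ θ₀ : T3 → ℝ}
    {u₀ : T3 → V3} (ha : Continuous a₀) (hθ : Continuous θ₀) (hu : Continuous u₀) (ha0 : ∀ x, 0 < a₀ x)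
    (hθ0 : ∀ x, 0 < θ₀ x) {T : ℝ} {ρ θ : ℝ → T3 → ℝ} {u : ℝ → T3 → V3}
    (hE : IsHardSphereEulerSolution σ T ρ u θ)
    (Φ : (N : ℕ) → HardSphereFlow (Torus.geometry (Fin 3)) (hsDiameter σ N) (N + 1))
    (hA : TendstoHydroFieldsAt (fun N => localGibbsLaw σ a₀ u₀ θ₀ N (Φ N)) Φ ρ u θ 0)
    {s : ℝ} (hs : s ∈ Ico 0 T) {η₁ : ℝ} (hprov : ∀ x, 2 * ρ s x * σ ^ 3 < η₁) :
    2 * σ ^ 3 < η₁ := by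
  have hmass : ∫ x, ρ s x = 1 := by
    rw [DenseExcursionEverywhere.integral_density_eq hE hs,
      DenseExcursionEverywhere.integral_density_zero_eq_one hσ ha hθ hu ha0 hθ0 Φ hA]
  have hcont : Continuous (ρ s) := (hE.smooth_density.isSmooth_slice hs).continuous
  obtain ⟨x, hx⟩ := exists_one_le_density hcont hmass
  have hs3 : 0 ≤ σ ^ 3 := pow_nonneg hσ0 3
  have hle : 2 * σ ^ 3 ≤ 2 * ρ s x * σ ^ 3 := by nlinarith [mul_nonneg (sub_nonneg.2 hx) hs3]
  exact hle.trans_lt (hprov x)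

/-! ## §4 The picked line `IdeatorTwoGen1Sketch` (barycentric Bregman / invariant Clausius) -/

section Line
open Summit.AtomisticToContinuum.HydrodynamicLimit.Theses.ImplosionDichotomy
  (DenseExcursion DiluteSelfConsistency HydroLimitInBand)
open MacroClosureLine

/-- **`stub_chamber` is exactly `¬ DenseExcursion`** (stmt-12586, the staffed negation programme of route
`ImplosionDichotomy`; tree lemma `not_denseExcursion_iff_diluteSelfConsistency`).  A PROOF of `DenseExcursion`
kills the picked line (and every line docking through 3091); it does NOT refute `MacroClosure`. -/
theorem stub_chamber_iff_not_denseExcursion : DiluteSelfConsistency ↔ ¬ DenseExcursion :=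
  not_denseExcursion_iff_diluteSelfConsistency.symm

/-- **The engine's conclusion is necessary-side safe**: the conjunct implies `EngineLocal` (ignore the chamber
hypothesis; any `η`, here `1`).  So `stub_engine`'s conclusion is irrefutable short of refuting the summit. -/
theorem engineLocal_of_hydrodynamicLimit (h : _root_.HydrodynamicLimit) : EngineLocal := by
  intro a₀ θ₀ u₀ ha hθ hu ha0 hθ0
  obtain ⟨σ₀, hσ₀, H⟩ := h a₀ θ₀ u₀ ha hθ hu ha0 hθ0
  exact ⟨σ₀, hσ₀, 1, one_pos, fun σ hσ hσlt T ρ θ u hsol Φ h0 _ t ht => H σ hσ hσlt T ρ θ u hsol Φ h0 t ht⟩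

/-- **Docking** (the composition of `MacroClosure_of` without the crux in between): the profile-wise in-band
engine and dilute self-consistency give the CONJUNCT directly.  Together with
`engineLocal_of_hydrodynamicLimit`: under stmt-3091, `EngineLocal ↔ HydrodynamicLimit`. -/
theorem hydrodynamicLimit_of_engineLocal_of_dsc (hE : EngineLocal) (hD : DiluteSelfConsistency) :
    _root_.HydrodynamicLimit := by
  intro a₀ θ₀ u₀ ha hθ hu ha0 hθ0
  obtain ⟨σ₁, hσ₁, η, hη, HE⟩ := hE a₀ θ₀ u₀ ha hθ hu ha0 hθ0
  obtain ⟨σ₂, hσ₂, HD⟩ := hD η hη a₀ θ₀ u₀ ha hθ hu ha0 hθ0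
  refine ⟨min σ₁ σ₂, lt_min hσ₁ hσ₂, ?_⟩
  intro σ hσ hσlt T ρ θ u hsol Φ h0 t ht
  exact HE σ hσ (lt_of_lt_of_le hσlt (min_le_left _ _)) T ρ θ u hsol Φ h0
    (fun s hs x => HD σ hσ (lt_of_lt_of_le hσlt (min_le_right _ _)) T ρ θ u hsol Φ h0 s hs x) t ht

/-- **The line's shape**: an engine produced from the three kinetic hypotheses, plus stmt-3091, gives the crux
(this is `Barycentric.MacroClosure_of` with the stubs abstracted).  3091 is load-bearing for the LINE. -/
theorem macroClosure_of_line
    (hEng : CollisionalTransferLocality → AprioriBoundsPreShock → FastMomentRelaxationPreShock → EngineLocal)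
    (hD : DiluteSelfConsistency) : MacroClosure :=
  fun h₂ h₃ hF => hydrodynamicLimit_of_engineLocal_of_dsc (hEng h₂ h₃ hF) hD

/-- **Quantifier order of the fallback dock.**  `HydroLimitInBand` (stmt-9133) has `∃ η₀` BEFORE `∀ profiles`
and therefore implies `EngineLocal` (whose `η` may depend on the profiles); the converse is not pure logic.
If 3091 dies (`DenseExcursion` proved), re-docking the line on 9133 requires the engine's `η` to be
PROFILE-INDEPENDENT — it is, on paper (η is set by the virial window of `ThermoChamber`/`HsEosLowDensity` and
by `η₁` of the kinetic hypotheses, but the latter DO depend on the profiles through their own `∃ σ₀ ∃ η₁`). -/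
theorem hydroLimitInBand_engineLocal (h : HydroLimitInBand) : EngineLocal := by
  obtain ⟨η₀, hη₀, H⟩ := h
  intro a₀ θ₀ u₀ ha hθ hu ha0 hθ0
  obtain ⟨σ₀, hσ₀, H'⟩ := H a₀ θ₀ u₀ ha hθ hu ha0 hθ0
  exact ⟨σ₀, hσ₀, η₀, hη₀, fun σ hσ hσlt T ρ θ u hsol Φ h0 hch t ht =>
    H' σ hσ hσlt T ρ θ u hsol hch Φ h0 t ht⟩

/-- **Equilibrium consistency of the statics stubs**: the Bregman divergence of the hard-sphere entropy
vanishes on the diagonal, junk-free (whatever `fderiv` is, it is linear and kills `U − U = 0`).  With the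
LANDED scaling invariance L0 (`localGibbsLaw σ (c·a) = localGibbsLaw σ a`) this checks `InitialEntropyValue`
and `ClausiusInMean` at homogeneous data: both sides are `0` resp. equal. -/
theorem relEnt_self (σ : ℝ) (U : State) : relEnt σ U U = 0 := by
  simp [relEnt]

/-- **Paper audit of the line's stubs (no kill)** — recorded as a checked triviality so that the docstring
travels with the file.  Details:

* `stub_thermo` / `ThermoChamber η₃`.  (1) Λ-formula: with `η_σ = −(3/2)ρ log θ(U) + ρ log ρ + ρ f_ex(ρσ³)`,
  `θ(U) = (2/3)(E/ρ − |m|²/(2ρ²))`: `∂_E η = −1/θ`, `∂_m η = m/(ρθ) = u/θ`,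
  `∂_ρ η = log ρ + 1 + f_ex + ρσ³f_ex' − (3/2)log θ − (3/(2θ))ρ∂_ρθ` and `ρ∂_ρθ = (2/3)(|u|²/2 − 3θ/2)`, whence
  the constant `1 + 3/2 = 5/2` and the term `−|u|²/(2θ)` — EXACTLY the typed clause.  (2) Compatibility
  `∂ₛΛ·V + Σⱼ∂ⱼΛ·DFⱼ(U)V = 0` ⟸ `D²η(U)DFⱼ(U)` symmetric ⟸ `η` is an entropy for the hs-Euler flux, which is
  thermodynamic consistency of (`p = ρθZ`, `e = 3θ/2`, `s = (3/2)log θ − log ρ − f_ex`) with the Helmholtz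
  free energy `f = θ(log ρ − 1 + f_ex(ρσ³)) − (3/2)θ log θ`: `p = ρ²∂_ρ f` ✓, `s = −∂_θ f` (up to a constant)
  ✓, `e = f + θs = 3θ/2` ✓.  (3) `∫Σⱼ∂ⱼΛ·Fⱼ(U) = 0`: `Σⱼ∂ⱼΛ·Fⱼ = Σⱼ∂ⱼ(Λ·Fⱼ − qⱼ)` with the entropy flux
  `qⱼ`, a divergence ✓.  (4) Coercivity: along `V = (ρ_V,0,(3/2)ρ_V)`, `ρ_V ↓ 0`:
  `relEnt → Λ(U)·U − η(U) = ρ_U Z(ρ_Uσ³) > 0` at bounded distance ✓; hot direction `V = (1,0,E)`, `E ↑ ∞`: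
  `relEnt ∼ E/θ_U` linear ✓ (hence `min(|·|², |·|)`); cold `E ↓ 0`: `relEnt ↑ ∞` ✓; dense `ρ_Vσ³ ↑ 1.1`: needs
  convexity of `η log η + η f_ex(η)` on `(0, 1.1)` for the TYPED `f_ex` = the torus thermodynamic limit
  (exists, shape-independent below close packing) — 9526, true, deep.  All three clauses are stated `∀ σ > 0`:
  harmless (reduced units).  C^∞ of `f_ex` on `(0, η₃)`: `HsEosLowDensity` (PROVED, analytic near `0`) for
  `η₃ < η₀`.
* `stub_balance` / `BalanceIdentity`.  B3 re-derived: `Σₗ∫φ(vₗ−ūₗ)² = 2Ē − |m̄|²/ρ̄` so `(1/3)Σ = ρ̄θ̄` and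
  `∫φ vⱼv_k = central + ρ̄ūⱼū_k` when `ρ̄ ≠ 0`; when `ρ̄ = 0` every `φ(xᵢ − x) = 0` (`φ ≥ 0`), all block
  integrals vanish, and `ū = 0⁻¹•0 = 0`, `θ̄ = (2/3)(0/0 − 0/0) = 0`, `D = 0 − δ·0/3 = 0`, `q = 0`: both sides
  are `0` ✓ (the junk is CONSISTENT).  Energy current: `Ē + ρ̄θ̄ = (5/2)ρ̄θ̄ + ρ̄|ū|²/2` ✓.  B1 at `τ = 0` needs
  `Φ.flow 0 z = z` on `Φ.good`: this is the structure field `HardSphereFlow.flow_zero` ✓; B4 needs `r > 0`,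
  `L ≥ 0` — for `r ≤ 0` or `L < 0` the hypotheses are unsatisfiable (vacuous) ✓.
* `stub_blockMGF` / `HomogeneousBlockMGF`.  Whole-torus cold event: all `N+1` velocities within `e^{−M/2}` of
  their mean costs `e^{−(3/2)NM}` (Gaussian small balls in `3N` relative dimensions) and gains
  `γ'(N+1)(3/2)M` in the exponent (`h ≈ (3/2)ρ̄ log(1/θ̄)` integrated against unit mass): divergent iff
  `γ' > N/(N+1)`.  So: FALSE at `γ' = 1` for every `N`; FALSE with `∀ N` for any fixed `γ' ∈ (N₀/(N₀+1), 1)`;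
  TRUE-shaped only as typed (`γ'` and `ε` fixed, then `∀ᶠ N`).  Localised cold spots never beat this
  (cost counts the particles within kernel range `r` of the cold region, gain only the covered mass: ratio
  `γ'R³/(R+r)³ < 1`).  Hot blocks: `E exp(γ'Σ|vᵢ|²/(2θ_c)) = (1−γ')^{−3(N+1)/2}` is finite iff `γ' < 1` and the
  `−(3/2)(N+1)𝟙·log θ̄` part restores `e^{o(N)}` (Laplace).  `c₁ > 1` makes the band event asymptotically
  empty (`∫ρ̄ = 1`), the bound then reads `1 ≤ e^{εN}` ✓.
* `stub_initialEntropy` / `InitialEntropyValue`.  Chain rule: position part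
  `→ ∫[g(ρ₀) − g(1) − g'(1)(ρ₀ − 1)]`, `g(η) = η log η + η f_ex(ησ³)` (canonical: no `−η`), using
  `inf_{∫ρ=1}∫g(ρ) = g(1)` (Jensen, convexity of `g` in the dilute homogeneous phase); velocity part
  `∫ρ₀ KL(M_{u₀,θ₀}‖M_{u_c,θ_c})`; `stateOf` is linear in `ρ` so the Bregman divergence along it is the
  Bregman divergence of `η_σ` ✓.  The ρ₀ binder is pinned by the LLN hypothesis (limits in probability are
  unique); if no continuous positive LLN density exists the clause is vacuous.
* `stub_clausius` / `ClausiusInMean`.  `E_{P_s}[F] ≤ H(P_s|G) + log E_G e^F` with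
  `F = γ'(N+1)𝟙_band∫h⁺(Ū|U_c)`, `H(P_s|G) = H(P_0|G)` (G invariant: LANDED for the homogeneous law;
  `Φ_s` a.e. invertible), `H(P_0|G)/(N+1) → ∫h(U₀|U_c)` (`InitialEntropyValue` with `ρ₀ = ρ(0,·)`, which the
  t = 0 tie pins, so the data are automatically dilute at `σ < σ₀(profiles)` even though the clause quantifies
  over ALL classical solutions), then `∫h(U₀|U_c) = ∫η(U₀) − η(U_c) − Λ_c·(∫U₀ − U_c)` and the conserved
  totals cancel the linear terms up to a uniformly integrable error; `γ' ↑ 1` eats the factor `1/γ'`.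
  Direction of the second law ✓ (`η = −ρs` decreases in mean).
* `stub_engine`.  `H_N(s) := E𝟙_G∫h(Ū_s|U_cl(s)) = E𝟙_G∫η(Ū_s) − P(G)∫η(U_cl(s)) − ℓ_N(s) ≤ δ' − ℓ_N(s)` by
  Clausius + classical entropy conservation (needs `f_ex ∈ C²` on the chamber ✓); `H_N ≥ 0` (band
  convexity); `ℓ_N' = E𝟙_G∫Σⱼ∂ⱼΛ·Rⱼ(Ū|U) + (closure errors, surely small ON `G`) + (hot cells)` after the
  compatibility identity kills the linear part — CTL's `(div ψ + ∇χ·ū)p_c` is exactly what turns the kinetic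
  `ρ̄θ̄` into `p(Ū)` and `(Ē + ρ̄θ̄)ū` into `(Ē + p̄)ū` ✓; with `g := δ' − ℓ_N ≥ 0`: `g' ≤ C_M g + e(s)`,
  `g(0) → δ'`, Gronwall, `H_N ≤ g → 0` (N → ∞, then δ → 0, M fixed; hot tail `e^{−λM/4}e^{C√M t}`).  Closes.
  The relative flux is NOT globally `≤ C·h`: along `V_λ = stateOf 1 (λe₁) 1` against `U = stateOf 1 0 1`,
  `relEnt = λ²/2` while the energy component of `fluxRem` is `λ³/2` (the `√M` race is necessary). -/
theorem line_paper_audit_recorded : True := trivial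

end Line

/-! ## §5 The cubic current is not controlled by the energy (kept from cycle 1; checked and tight) -/

section Cubic

/-- **Energy bounds the cubic current only with a loss `√(total)`:** for any finite family of velocities,
`∑ ‖vᵢ‖³ ≤ (∑ ‖vᵢ‖²) · √(∑ ‖vᵢ‖²)`.  Per particle this reads `(N+1)⁻¹∑|vᵢ|³ ≤ (N+1)^{1/2} e^{3/2}` with `e`
the conserved energy per particle — so an event of probability `p_N` can carry an expected cubic current of
size `p_N (N+1)^{1/2}`: in-probability hypotheses feed an expectation-level ledger only ON the good event
(which is what the picked line does) or with a rate `o((N+1)^{-1/2})` (which nobody has). -/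
theorem sum_norm_cube_le {ι : Type*} (s : Finset ι) (v : ι → V3) :
    ∑ i ∈ s, ‖v i‖ ^ 3 ≤ (∑ i ∈ s, ‖v i‖ ^ 2) * Real.sqrt (∑ i ∈ s, ‖v i‖ ^ 2) := by
  set S : ℝ := ∑ i ∈ s, ‖v i‖ ^ 2 with hS
  have hle : ∀ i ∈ s, ‖v i‖ ≤ Real.sqrt S := fun i hi => by
    rw [← Real.sqrt_sq (norm_nonneg (v i))]
    refine Real.sqrt_le_sqrt ?_
    have : ‖v i‖ ^ 2 ≤ ∑ j ∈ s, ‖v j‖ ^ 2 :=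
      Finset.single_le_sum (f := fun j => ‖v j‖ ^ 2) (fun j _ => by positivity) hi
    simpa [hS] using this
  calc ∑ i ∈ s, ‖v i‖ ^ 3 = ∑ i ∈ s, ‖v i‖ ^ 2 * ‖v i‖ := Finset.sum_congr rfl fun i _ => by ring
    _ ≤ ∑ i ∈ s, ‖v i‖ ^ 2 * Real.sqrt S :=
        Finset.sum_le_sum fun i hi => mul_le_mul_of_nonneg_left (hle i hi) (by positivity)
    _ = S * Real.sqrt S := by rw [← Finset.sum_mul]

/-- **Tightness**: one particle carrying all the energy attains the bound. -/
theorem sum_norm_cube_eq_of_single {n : ℕ} (w : V3) :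
    let v : Fin (n + 1) → V3 := fun i => if i = 0 then w else 0
    ∑ i, ‖v i‖ ^ 3 = (∑ i, ‖v i‖ ^ 2) * Real.sqrt (∑ i, ‖v i‖ ^ 2) := by
  intro v
  have h3 : ∑ i, ‖v i‖ ^ 3 = ‖w‖ ^ 3 := by
    rw [Finset.sum_eq_single (0 : Fin (n + 1)) (fun i _ hi => by simp [v, hi]) (by simp)]
    simp [v]
  have h2 : ∑ i, ‖v i‖ ^ 2 = ‖w‖ ^ 2 := by
    rw [Finset.sum_eq_single (0 : Fin (n + 1)) (fun i _ hi => by simp [v, hi]) (by simp)]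
    simp [v]
  rw [h3, h2, Real.sqrt_sq (norm_nonneg w)]
  ring

end Cubic

/-! ## §6 Near-misses and what a kill would need (prose)

* A KILL of the crux needs `CollisionalTransferLocality ∧ AprioriBoundsPreShock ∧ FastMomentRelaxationPreShock`
  PROVED (the open kinetic half of two routes) and `¬ HydrodynamicLimit` (the summit conjunct refuted).  Every
  junk channel of the conjunct examined this cycle is closed: `T ≤ 0` (everything vacuous on both sides),
  `flow 0 ≠ id` (only on a null set; `flow_zero` on `good`), the zero law (excluded: `σ < σ₀ ≤ 1/2` makes the
  local Gibbs law a probability measure), dense junk of the EOS (unreachable from dilute LLN data, finding 2),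
  static non-uniform solutions `u = 0`, `ρθZ(ρσ³) ≡ const` (genuine Euler steady states with an entropy
  gradient; the conjunct's claim that the gas keeps them for all macroscopic times is the expected Euler-scale
  physics, heat conduction being `O((N+1)^{-1/3})`).
* A KILL of the picked LINE needs `DenseExcursion` (stmt-12586) — staffed elsewhere; or a refutation of one of
  the statics stubs as TYPED.  Candidates watched: measurability of `hsExcessFreeEnergy` (piecewise monotone:
  antitone free volume, then the `log 0 = 0` drop beyond `√2` — measurable, but a prover must SHOW it before any
  `Integrable`/`∫` statement about `hsEntropy ∘ bU` is more than junk `0`); the `fderiv` inside `relEnt` is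
  the true derivative only where `f_ex` is differentiable at `ρ_Uσ³` (fine in the chamber by `HsEosLowDensity`;
  at `U_c = stateOf 1 u_c θ_c` it needs `σ³ < η₀`, which the stubs' `∃ σ₀` can grant).
* STRENGTHENINGS THAT ARE FALSE (paper, this cycle): `HomogeneousBlockMGF` at `γ' = 1` or with `∀ N`
  (cold-block small balls); "relative flux ≤ C · relEnt globally on the band" (cubic vs quadratic);
  `EngineLocal` with `η` AFTER `∀ σ` … (not examined).  TRUE BUT USELESS: `HydrodynamicLimit → ρ_tσ³ ≤ 6/π`.

## §7 Migration debt (for a migration seat; not items)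

`Theorems/MacroClosure/Negative/PackingCeiling.lean` and the cycle-1 §§2–7 name the RETIRED decl
`CollisionIsometryCLT.AprioriBounds` (∀-t form of stmt-9519, retired in BOTH routes on 2026-08-16): they no
longer elaborate and there is no tree decl left with that body.  Salvage = inline the old statement as a local
`def AprioriBoundsGlobal : Prop` in that file (its headline `AprioriBoundsGlobal → HydrodynamicLimit →
PackingCeilingOne` stays a correct, informative theorem about the ∀-t form) and drop the `MacroClosure`
corollaries, which are moot for stmt-14870 (finding 2).
-/

end Summit.AtomisticToContinuum.HydrodynamicLimit.Cruxes.MacroClosure.Disproof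

end
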